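import Mathlib
import HarnessLib
import HarnessLib.Audit
import Summits.HodgeConjecture.Statement
import Literature.AlgebraicGeometry.Motives.AbelianVariety
import Literature.AlgebraicGeometry.HodgeTheory.WeilClasses
import Literature.AlgebraicGeometry.HodgeTheory.GysinFormalism
import Literature.AlgebraicGeometry.HodgeTheory.HardLefschetzThreefold
import Literature.AlgebraicGeometry.HodgeTheory.AbelianLowDimensionHodgeConjecture
import Literature.Barriers.HodgeConjecture.ExceptionalHodgeClasses
import Literature.AlgebraicGeometry.HodgeTheory.ComplexConjugationHolds
import Literature.AlgebraicGeometry.HodgeTheory.AbelianLowDimensionWeilReductionProofs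
import Literature.AlgebraicGeometry.HodgeTheory.HardLefschetzNFoldHolds
import Literature.AlgebraicGeometry.HodgeTheory.LefschetzOneOneHolds
import HarnessLib.Audit.Status.Attr

/-!
Route: SevenfoldWeilCensus

# Route SevenfoldWeilCensus — Hodge for abelian 6- and 7-folds by a Hodge-group census two
dimensions past Moonen–Zarhin: every exceptional class is a sixfold Weil class

X = X2 ∧ X1 ∧ X3 ("it suffices to show", for the conjunct HC(complex abelian varieties of dimension
≤ 7); the two other
conjuncts of the summit — abelian varieties of dimension ≥ 8 and varieties carrying no
abelian-variety structure — are the declared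
residuals R1 `HodgeAbelianDimGeEight`, R2 `AbelianComplement` (shared verbatim with RankFourFaces)).
X2 (CODIM-2 CENSUS): on a complex
abelian 6- or 7-fold every rational (2,2)-class lies in D² + pull-backs of rational (2,2)-classes
from abelian varieties of smaller
dimension. X1 (CODIM-3 WEIL GENERATION): every rational (3,3)-class lies in D³ + B²·B¹ + pull-backs
of rational (3,3)-classes from
smaller dimension + pull-backs of WEIL classes of sixfolds of Weil type. X3 (WEIL SIXFOLDS, the
existing shared crux
stmt-HodgeConjecture-2524): Weil classes on abelian sixfolds of Weil type are algebraic. With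
Markman's dim ≤ 5 theorem (support, by
name) the kernel-checked glue gives HC for every complex abelian variety of dimension ≤ 7. Realises
sketch abelian-sevenfold-weil-census.
Lean: `∀ A : Literature.AlgebraicGeometry.Motives.AbelianVariety ℂ, A.dim ≤ 7 →
Literature.AlgebraicGeometry.Motives.IsSmoothProjective A.dim A.X →
Literature.AlgebraicGeometry.HodgeTheory.HodgeConjectureFor A.dim A.X`

## Assembly
`closes (hA : Assembly) (h₃ : CodimTwoFromLowerDim) (h₂ : CodimThreeWeilGeneration) (h₄ :
WeilSixfolds) (h₅ : HodgeAbelianDimLeFive) (h₈ : HodgeAbelianDimGeEight) (h₉ : AbelianComplement) :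
HodgeConjecture` is the case split abelian-of-dim ≤ 7 (hA fed with the four cruxes/support) /
abelian ≥ 8 (R1) / no abelian structure (R2). The Assembly item itself (the sevenfold reduction) is
PROVED in the folder (scratch/AssemblyProof.lean, sorry-free, axioms
propext/Classical.choice/Quot.sound; attached as evidence for a prover to land): strong induction on
dim A ≤ 7 —
dim ≤ 5 by the support fact; on 6- /7-folds p = 0 trivial, p = 1 Lefschetz (1,1)
(`lefschetzOneOne_rational_holds`), p = 2 by X2 +
`AbelianVariety.divisorClassesSpan_le_algebraicClasses` + pull-back preservation
(`map_mem_algebraicClasses_of_abelianVariety`) + the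
induction hypothesis, p = 3 by X1 + the same + Kleiman cup with a divisor
(`AbelianVariety.cupProduct_mem_algebraicClasses_one`) + X3 on
the Weil generators (`weilClassesOf = E₊ ⊔ E₋`), 2p > dim by hard Lefschetz
(`mem_algebraicClasses_of_lt_of_nonempty`,
`nonempty_hardLefschetzNFold_holds`); the anti-vacuity conjunct of `HodgeConjectureFor` comes from
the tree theorem `nonempty_hodgeModel_holds` inside `closes`.

Rationale: WHY THIS LINE. Moonen–Zarhin (arXiv:math/9901113, Math. Ann. 315) computed the Hodge group of EVERY
complex abelian variety of dimension ≤ 5 and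
showed the Hodge ring is generated by divisor classes and (pull-backs of) Weil classes of fourfold
factors; Markman (arXiv:2502.03415,
Markman2025SecantWeil) made those Weil classes algebraic, closing HC in dimension ≤ 5. The line runs
the same Mumford–Tate census two
dimensions further, where the only new irreducible source of exceptional classes the classification
predicts is the 2-dimensional
Weil space W_K of a SIXFOLD of Weil type (codimension 3); in dimension 8 genuinely non-Weil
exceptional classes appear (B²(X²) for
Mumford's fourfolds, MZ99 Thm. (d)(3)), which is why the census stops at 7. Imported: representation
theory of Hodge groups /
Mumford–Tate classification (Deligne1982HodgeCycles, MoonenZarhin1999), Pohlmann's CM combinatorics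
for the CM strata; the geometry
(algebraicity) is confined to the one shared crux X3. No prior route of this summit attacks the
abelian locus by dimension; the
negatives index (3 entries: MilnorK symbol lift, Fermat K3 exhaustion, E-line transport) is disjoint
from these statements.

RANKED CRUXES. #2 CodimThreeWeilGeneration (crux) — X1 — for every complex abelian variety A of
dimension 6 or 7, every rational (3,3)-class in H⁶(A;ℂ) lies in the ℂ-span of divisor monomials D³ ⊔
span of cup products (rational (2,2)-class)·(rational (1,1)-class) ⊔ span of pull-backs g*w of
rational (3,3)-classes w of abelian varieties C with dim C < dim A along morphisms g : A → C ⊔ span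
of pull-backs of Weil classes (w ∈ weilClassesOf B ψ 3 d, ψ² = −d) of abelian sixfolds B along g : A
→ B (sketch item X1). [deps: CodimTwoFromLowerDim] [difficulty: L] (why it might fail: a simple
6- /7-fold with small Hodge group — degenerate CM type with non-abelian Galois closure (Dodson 1984
§3.2, §5.3), type IV over a CM field of degree 4/6, or type III — may carry (3,3)-classes neither
Weil for any ψ² = −d nor decomposable; the kernel census covers abelian Galois groups only.)
[arXiv:math/9901113, MoonenZarhin1999, doi:10.1215/s0012-7094-95-07717-5, Deligne1982HodgeCycles,
Weil1977HodgeRing, vanGeemen1994HodgeAV, doi:10.2307/1999987]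
#3 CodimTwoFromLowerDim (crux) — X2 — for every complex abelian variety A of dimension 6 or 7, every
rational (2,2)-class in H⁴(A;ℂ) lies in the ℂ-span of divisor monomials D² ⊔ span of pull-backs g*w
of rational (2,2)-classes w of abelian varieties C with dim C < dim A along morphisms g : A → C (so
all codimension-2 exceptional classes come from Weil/Mumford-type fourfold and fivefold quotients)
(sketch item X2). [difficulty: L] (why it might fail: a degenerate CM sixfold with non-abelian
Galois closure (Dodson 1984), a simple type-IV sixfold with an imaginary quadratic field of
multiplicities (1,5)/(2,4), or a sevenfold with multiplicities (k,7−k) may carry exceptional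
(2,2)-classes with no lower-dim source (MZ99 case (b) one rank up).) [arXiv:math/9901113,
MoonenZarhin1999, doi:10.1515/crll.1998.034, Deligne1982HodgeCycles, doi:10.2307/1999987]
#4 WeilSixfolds (crux) — X3 — VERBATIM the shared crux `TropicalCuspLift.WeilSixfolds`
(stmt-HodgeConjecture-2524): for every d > 0 and every abelian sixfold A with φ² = −d, every
rational (3,3)-class that splits as an E₊ ⊕ E₋ eigen-pair for the action of x + yφ (i.e. a Weil
class of (A, ℚ(√−d))) is algebraic. [difficulty: open-problem] (why it might fail: known only for
ℚ(√−3), det H = 1 (Schoen, Prym of 3:1 covers) and for discriminant −1 general members (Markman 2025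
secant sheaves); other discriminant classes in ℚ*/N(K*) have no construction and the secant sheaf
may fail to deform there.) [arXiv:2502.03415, arXiv:2509.23403, vanGeemen1994HodgeAV,
Markman2025SecantWeil]
#8 HodgeAbelianDimGeEight (crux) — R1 (declared RESIDUAL conjunct, not attacked by this route) — the
Hodge conjecture for complex abelian varieties of dimension ≥ 8, where non-Weil exceptional classes
exist (MZ99 Thm. (d)(3): B²(X²) for Mumford-type fourfolds X). [difficulty: open-problem] (why it
might fail: it is the Hodge conjecture for abelian varieties of dimension ≥ 8 — open, with
exceptional classes outside every known construction (Mumford-type X², general Weil 2n-folds n ≥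
4).) [arXiv:math/9901113, Weil1977HodgeRing, Deligne1982HodgeCycles, Andre1996Motifs]
#9 AbelianComplement (crux) — R2 (declared RESIDUAL conjunct, shared VERBATIM with
`RankFourFaces.AbelianComplement`, stmt-HodgeConjecture-15889) — the Hodge conjecture for smooth
projective varieties carrying no abelian-variety structure of their dimension. [difficulty:
open-problem] (why it might fail: it is the Hodge conjecture off the abelian locus (surfaces of
general type products, hyperkähler, Calabi–Yau …) — summit-strength residual, imported not
attacked.) [Deligne1982HodgeCycles, Andre1996Motifs, vanGeemen1994HodgeAV]
#9 HodgeAbelianDimLeFive (support) — Markman 2025 Cor. 1.3 with Moonen–Zarhin 1999: the Hodge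
conjecture (cycle part) for complex abelian varieties of dimension ≤ 5 — BY NAME the claim-tagged
Literature fact `Markman2025_hodgeClasses_algebraic_abelian_dim_le_five` (the induction base of the
glue). [difficulty: open-problem] [arXiv:2502.03415, arXiv:math/9901113, Markman2025SecantWeil]

TWO-LAYER PLAN. Foreseen glued splits once typing of simplicity lands (definition request below): X2
⇐ X2(simple 6- /7-folds, by Albert type) → X2(non-simple,
product lemmas MZ99 §3) → X2; X1 ⇐ X1(dim 6) → X1(dim 7) → X1 (the birth skeleton), later refined by
Albert type; nothing filed now.

KILL CRITERIA. One explicit abelian 6- or 7-fold (CM or a Mumford–Tate family) with a rational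
(2,2)-class outside D² + lower-dimensional pull-backs
refutes X2 (`close --reason refuted:CodimTwoFromLowerDim` unless the witness is itself a Weil-type
pull-back one can add as a
generator — then restate); a (3,3)-class outside the four spans refutes X1 likewise. A non-algebraic
Weil class on a sixfold refutes
X3 and, by André (motivated classes), the standard conjecture B — it would close every abelian route
of the summit. HC for abelian
varieties proved elsewhere (e.g. via RankFourFaces.CMToAbelian + FaceReduction) moots the route.

NOT DECOMPOSED YET. The simple/non-simple × Albert-type case tree of X1/X2 (needs an
`IsSimple`/isogeny-decomposition API for `AbelianVariety ℂ` the tree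
lacks); the identification of the tree's abstract `weilClassesOf B ψ p d` with ⋀⁶_K H¹ (MZ99 §2);
the discriminant case split of X3;
the CM strata (handled informationally by the Pohlmann certificate
bc/CodimThreeWeilGeneration_rung.lean).

CHEAPEST FALSIFIER. The CM census: for CM abelian sixfolds A_Φ with Galois CM field, Pohlmann's
criterion makes B^p(A_Φ) a finite combinatorial object;
enumerate all CM types and test X1/X2's generation statements. Run (sketch probe cmprobe.py, Galois
groups of order 12 incl. C₁₂,
C₂×C₆: 0 violations) and re-done in Lean as the BC5 rung (decide, kernel) for the abelian Galois
groups C₁₂ and C₂×C₆. Next cheapest: the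
Mumford–Tate tables of simple type-IV sixfolds with an imaginary quadratic field of multiplicity
(1,5)/(2,4) (MZ 1998 Crelle, doi:10.1515/crll.1998.034).

NUMBERS. dim ≤ 3: B = D (Tankeev/Ribet/MZ); dim 4, 5: B generated by D and Weil classes W_K of
fourfold factors (MZ99 Thms. 0.1–0.2); dim 6:
general Weil sixfolds have dim B³ = dim D³ + 2 (W_K, vanGeemen1994HodgeAV 4.11/7.3); dim 8: non-Weil
exceptional classes in B²(X²),
X Mumford-type (MZ99 (d)(3)). Items at open: 7 (3 attacked cruxes, 2 residual cruxes, 1 support, 1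
assembly).

DEFINITION REQUESTS. `AbelianVariety.IsSimple` / isogeny decomposition into simple factors for
`Literature.AlgebraicGeometry.Motives.AbelianVariety ℂ` (the
tree has `IsIsogenous`, `endAlgebra`, `prodLift` but no simplicity predicate) — wanted for the
layer-2 split of X1/X2, not for the items
as filed.

Novelty: Searches (2026-08-17): `lit search "Moonen Zarhin Hodge classes abelian varieties low dimension"`
(12 local docs: MZ99 held as
paper:arxiv-math_9901113; Markman arXiv:2509.23403 p4, arXiv:2502.03415 p7; remote: MZ95 Duke, MZ98
Crelle, Murty 2000); `lit read
paper:arxiv-math_9901113 --grep 'dimension 6|six|higher dimension'` → 0 hits (MZ99 stop at 5); `lit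
vsearch "classification of Hodge
classes on abelian varieties of dimension six or seven …"` (10 docs: Voisin I p218,
Green–Murre–Voisin LNM 1594 pp 214–234 = van
Geemen's lectures, Kerr–Pearlstein 2016, Deligne LNM 900); `lit galaxy search "Moonen-Zarhin|Moonen
and Zarhin|exceptional Hodge class"
--star all` (4 panama books: Contemp. Math. 487, Huybrechts K3, LNM 1594, Mumford Selected Papers;
pdf/crabby 0); `lit galaxy search
"abelian sixfold|abelian varieties of dimension 6|Weil type of dimension 6|dimension six of Weil"
--star all` (1 panama: Mumford Selected
Papers; 0 elsewhere).
Nearest prior art found: arXiv:math/9901113 (MoonenZarhin1999: the census in dim ≤ 5, Hodge ring =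
⟨D, W_K of fourfold factors⟩);
[corpus:book:green1994-algebraic-cycles-hodge-theory-lectures-given-at p.234] van Geemen 7.3
(Schoen: Weil (3,3)-classes algebraic on
the general Weil sixfold with K = ℚ(√−3), det H = 1); arXiv:2502.03415 (Markman: Weil classes of
discriminant −1 sixfolds, hence HC in
dim ≤ 5); no text found treating the full Hodge-class census in dimension 6 or 7.
Delta: states and isolates the dimension-6/7 census (X1, X2) as the tw  [refs: 2509.23403, 2502.03415, math/9901113, paper:arxiv-math_9901113, book:green1994-algebraic-cycles-hodge-theory-lectures-given-at, MoonenZarhin1999]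

Barriers (technique_class: hodge-group-census, mumford-tate, weil-classes, reduction): - technique_class: hodge-group-census, mumford-tate, weil-classes, reduction
- Literature.Barriers.HodgeConjecture.Andre1996_hodgeClassesOnAbelianVarieties_motivated: it blocks
REFUTING HC by a non-algebraic Hodge class on a complex abelian variety (such a class would be
motivated, so it would sink standard conjecture B); this route sits on the proving side and its kill
path is different in kind — X1/X2 die by exhibiting a Hodge class OUTSIDE the named span (divisors +
lower-dimensional pull-backs + Weil pull-backs), a pure Hodge-structure computation (CM census /
Mumford–Tate tables) that asserts nothing about algebraicity, so the barrier does not quantify over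
our refutations; X3 (Weil sixfolds) is exactly the statement André's theorem makes equivalent to B
for these varieties, attacked by geometry (Schoen, Markman 2025), and a counterexample to X3 is not
something this route bets on.
- Literature.Barriers.HodgeConjecture.AtiyahHirzebruch1962_torsionClass_notAlgebraic: outside —
every item is stated for rational classes (`IsRationalClass`) and ℂ-spans; torsion phenomena are
invisible.
- Literature.Barriers.HodgeConjecture.Kollar1992_nonTorsionClass_notAlgebraic: outside — same reason
(ℚ-coefficients throughout; no integral generation claim is made, X1/X2 are about ℂ-spans).
- Literature.Barriers.HodgeConjecture.Grothendieck1969_generalHodgeConjecture_false: outside — no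
item invokes the generalised (coniveau) Hodge conjecture; X2's "pull-back from quotients of smaller
dimen

sub-problem: HodgeConjecture · status: draft · opened planner-type-24c06cf1ee-0 2026-08-17T17:18:52Z · rev 0 · ledger route-HodgeConjecture-SevenfoldWeilCensus
GENERATED by the gate from the ledger (D-0016/17). Provers cite these decls: `theorem foo : Summit.HodgeConjecture.HodgeConjecture.Theses.SevenfoldWeilCensus.<Decl> := …` in Summits/HodgeConjecture/HodgeConjecture/Theorems/<Name>.lean.
-/

namespace Summit.HodgeConjecture.HodgeConjecture.Theses.SevenfoldWeilCensus

open scoped BigOperators Topology Manifold Classical MeasureTheory ProbabilityTheory Matrix InnerProductSpace ComplexConjugate ContinuousMap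
open Filter Set Function TopologicalSpace MeasureTheory

attribute [summit_statement] _root_.HodgeConjecture

/-- item stmt-HodgeConjecture-18720 · crux · rank 2 · open · by planner
why it might fail: a simple 6- /7-fold with small Hodge group — degenerate CM type with non-abelian Galois closure (Dodson 1984 §3.2, §5.3), type IV over a CM field of degree 4/6, or type III — may carry (3,3)-classes neither Weil for any ψ² = −d nor decomposable; the kernel census covers abelian Galois groups only.
sources: arXiv:math/9901113, MoonenZarhin1999, doi:10.1215/s0012-7094-95-07717-5, Deligne1982HodgeCycles, Weil1977HodgeRing, vanGeemen1994HodgeAV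
[crux] X1 — for every complex abelian variety A of dimension 6 or 7, every rational (3,3)-class in
H⁶(A;ℂ) lies in the ℂ-span of divisor monomials D³ ⊔ span of cup products (rational
(2,2)-class)·(rational (1,1)-class) ⊔ span of pull-backs g*w of rational (3,3)-classes w of abelian
varieties C with dim C < dim A along morphisms g : A → C ⊔ span of pull-backs of Weil classes (w ∈
weilClassesOf B ψ 3 d, ψ² = −d) of abelian sixfolds B along g : A → B (sketch item X1). [deps:
CodimTwoFromLowerDim] [difficulty: L] -/
@[route_item "route-HodgeConjecture-SevenfoldWeilCensus", crux]
def CodimThreeWeilGeneration : Prop :=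
  ∀ A : Literature.AlgebraicGeometry.Motives.AbelianVariety ℂ, A.dim = 6 ∨ A.dim = 7 → ∀ c : Literature.AlgebraicGeometry.HodgeTheory.complexBetti A.X (2 * 3), Literature.AlgebraicGeometry.HodgeTheory.IsRationalClass c → Literature.AlgebraicGeometry.HodgeTheory.IsOfHodgeType A.dim A.X (2 * 3) 3 3 c → c ∈ Literature.Barriers.HodgeConjecture.divisorClassesSpan A.X A.dim 3 ⊔ Submodule.span ℂ {w' : Literature.AlgebraicGeometry.HodgeTheory.complexBetti A.X (2 * 3) | ∃ (a : Literature.AlgebraicGeometry.HodgeTheory.complexBetti A.X (2 * 2)) (b : Literature.AlgebraicGeometry.HodgeTheory.complexBetti A.X (2 * 1)), Literature.AlgebraicGeometry.HodgeTheory.IsRationalClass a ∧ Literature.AlgebraicGeometry.HodgeTheory.IsOfHodgeType A.dim A.X (2 * 2) 2 2 a ∧ Literature.AlgebraicGeometry.HodgeTheory.IsRationalClass b ∧ Literature.AlgebraicGeometry.HodgeTheory.IsOfHodgeType A.dim A.X (2 * 1) 1 1 b ∧ w' = Literature.AlgebraicTopology.SingularHomology.cupProduct (Literature.AlgebraicGeometry.HodgeTheory.two_mul_add_two_mul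 2 1) a b} ⊔ Submodule.span ℂ {w' : Literature.AlgebraicGeometry.HodgeTheory.complexBetti A.X (2 * 3) | ∃ (C : Literature.AlgebraicGeometry.Motives.AbelianVariety ℂ) (g : A.X ⟶ C.X) (w : Literature.AlgebraicGeometry.HodgeTheory.complexBetti C.X (2 * 3)), C.dim < A.dim ∧ Literature.AlgebraicGeometry.HodgeTheory.IsRationalClass w ∧ Literature.AlgebraicGeometry.HodgeTheory.IsOfHodgeType C.dim C.X (2 * 3) 3 3 w ∧ w' = Literature.AlgebraicGeometry.HodgeTheory.complexBetti.map g (2 * 3) w} ⊔ Submodule.span ℂ {w' : Literature.AlgebraicGeometry.HodgeTheory.complexBetti A.X (2 * 3) | ∃ (B : Literature.AlgebraicGeometry.Motives.AbelianVariety ℂ) (g : A.X ⟶ B.X) (d : ℕ) (ψ : B ⟶ B) (w : Literature.AlgebraicGeometry.HodgeTheory.complexBetti B.X (2 * 3)), B.dim = 6 ∧ 0 < d ∧ CategoryTheory.CategoryStruct.comp ψ ψ = -(d • CategoryTheory.CategoryStruct.id B) ∧ Literature.AlgebraicGeometry.HodgeTheory.IsRationalClass w ∧ Literature.AlgebraicGeometry.HodgeTheory.IsOfHodgeType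 B.dim B.X (2 * 3) 3 3 w ∧ w ∈ Literature.AlgebraicGeometry.HodgeTheory.weilClassesOf B ψ 3 d ∧ w' = Literature.AlgebraicGeometry.HodgeTheory.complexBetti.map g (2 * 3) w}

/-- item stmt-HodgeConjecture-18721 · crux · rank 3 · open · by planner
why it might fail: a degenerate CM sixfold with non-abelian Galois closure (Dodson 1984), a simple type-IV sixfold with an imaginary quadratic field of multiplicities (1,5)/(2,4), or a sevenfold with multiplicities (k,7−k) may carry exceptional (2,2)-classes with no lower-dim source (MZ99 case (b) one rank up).
sources: arXiv:math/9901113, MoonenZarhin1999, doi:10.1515/crll.1998.034, Deligne1982HodgeCycles, doi:10.2307/1999987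
[crux] X2 — for every complex abelian variety A of dimension 6 or 7, every rational (2,2)-class in
H⁴(A;ℂ) lies in the ℂ-span of divisor monomials D² ⊔ span of pull-backs g*w of rational
(2,2)-classes w of abelian varieties C with dim C < dim A along morphisms g : A → C (so all
codimension-2 exceptional classes come from Weil/Mumford-type fourfold and fivefold quotients)
(sketch item X2). [difficulty: L] -/
@[route_item "route-HodgeConjecture-SevenfoldWeilCensus", crux]
def CodimTwoFromLowerDim : Prop :=
  ∀ A : Literature.AlgebraicGeometry.Motives.AbelianVariety ℂ, A.dim = 6 ∨ A.dim = 7 → ∀ c : Literature.AlgebraicGeometry.HodgeTheory.complexBetti A.X (2 * 2), Literature.AlgebraicGeometry.HodgeTheory.IsRationalClass c → Literature.AlgebraicGeometry.HodgeTheory.IsOfHodgeType A.dim A.X (2 * 2) 2 2 c → c ∈ Literature.Barriers.HodgeConjecture.divisorClassesSpan A.X A.dim 2 ⊔ Submodule.span ℂ {w' : Literature.AlgebraicGeometry.HodgeTheory.complexBetti A.X (2 * 2) | ∃ (C : Literature.AlgebraicGeometry.Motives.AbelianVariety ℂ) (g : A.X ⟶ C.X) (w : Literature.AlgebraicGeometry.HodgeTheory.complexBetti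 C.X (2 * 2)), C.dim < A.dim ∧ Literature.AlgebraicGeometry.HodgeTheory.IsRationalClass w ∧ Literature.AlgebraicGeometry.HodgeTheory.IsOfHodgeType C.dim C.X (2 * 2) 2 2 w ∧ w' = Literature.AlgebraicGeometry.HodgeTheory.complexBetti.map g (2 * 2) w}

/-- item stmt-HodgeConjecture-2524 · crux · rank 4 · open · by planner
why it might fail: known only for ℚ(√−3), det H = 1 (Schoen, Prym of 3:1 covers) and for discriminant −1 general members (Markman 2025 secant sheaves); other discriminant classes in ℚ*/N(K*) have no construction and the secant sheaf may fail to deform there.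
sources: arXiv:2502.03415, arXiv:2509.23403, vanGeemen1994HodgeAV, Markman2025SecantWeil
[crux, rank 3] X(3): Weil classes on abelian SIXFOLDS (A, φ² = -d) are algebraic — the thesis at n =
3, inlined. Markman (arXiv:2502.03415) proves it on the components of discriminant -1 for every K =
ℚ(√-d) via a simple reflexive secant sheaf on X×X̂ (X an abelian threefold) deformed by
Buchweitz–Flenner semiregularity over the 9-dimensional Weil moduli; Schoen did K = ℚ(√-3), trivial
discriminant. By the Witt-index dictionary the disc ≡ -1 components are exactly the ones with a
totally toric (maximal unipotent) cusp; the open components (disc ≢ -1) have Witt index 2: their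
deepest degeneration has torus rank 4 over a (1,1) K-abelian surface (E×E with K ⊂ M₂(ℚ)), and their
depth-1 cusps sit over level-2 Weil fourfolds of discriminant -disc, where Markman's theorem AND his
semiregular secant sheaves are available — so X(3) is ONE application of the depth-1 lift
(WittTowerStep at n = 2) away from print, which is why it is ranked right after the step. It is also
the natural shared target of the direct attacks filed as other cards (weil-discriminant-exposed-ray:
exposed rays rational iff (-1)^n det H trivial; volume-form-lagrangians-weil-classes;
mirror-lagrangian-branes-for-weil-clas -/
@[route_item "route-HodgeConjecture-SevenfoldWeilCensus", crux]
def WeilSixfolds : Prop :=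
  ∀ (d : ℕ), 0 < d → ∀ (A : Literature.AlgebraicGeometry.Motives.AbelianVariety ℂ) (φ : A ⟶ A), A.dim = 2 * 3 → Literature.AlgebraicGeometry.Motives.IsSmoothProjective (2 * 3) A.X → CategoryTheory.CategoryStruct.comp φ φ = -(d • CategoryTheory.CategoryStruct.id A) → ∀ c : Literature.AlgebraicTopology.SingularHomology.singularCohomology ℂ ℂ (Literature.AlgebraicGeometry.Motives.ComplexPoints A.X) (2 * 3), Literature.AlgebraicGeometry.HodgeTheory.IsRationalClass c → Literature.AlgebraicGeometry.HodgeTheory.IsOfHodgeType (2 * 3) A.X (2 * 3) 3 3 c → (∃ c₁ c₂ : Literature.AlgebraicTopology.SingularHomology.singularCohomology ℂ ℂ (Literature.AlgebraicGeometry.Motives.ComplexPoints A.X) (2 * 3), c = c₁ + c₂ ∧ (∀ x y : ℕ, Literature.AlgebraicTopology.SingularHomology.singularCohomology.map ℂ ℂ (Literature.AlgebraicGeometry.Motives.AlgPoints.mapContinuous (L := ℂ) (x • CategoryTheory.CategoryStruct.id A + y • φ).hom.hom.hom) (2 * 3) c₁ = ((x : ℂ) + (y : ℂ) * Complex.I *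 (Real.sqrt d : ℂ)) ^ (2 * 3) • c₁) ∧ (∀ x y : ℕ, Literature.AlgebraicTopology.SingularHomology.singularCohomology.map ℂ ℂ (Literature.AlgebraicGeometry.Motives.AlgPoints.mapContinuous (L := ℂ) (x • CategoryTheory.CategoryStruct.id A + y • φ).hom.hom.hom) (2 * 3) c₂ = ((x : ℂ) - (y : ℂ) * Complex.I * (Real.sqrt d : ℂ)) ^ (2 * 3) • c₂)) → c ∈ Literature.AlgebraicGeometry.HodgeTheory.algebraicClasses A.X 3

/-- item stmt-HodgeConjecture-18722 · crux · rank 8 · open · by planner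
why it might fail: it is the Hodge conjecture for abelian varieties of dimension ≥ 8 — open, with exceptional classes outside every known construction (Mumford-type X², general Weil 2n-folds n ≥ 4).
sources: arXiv:math/9901113, Weil1977HodgeRing, Deligne1982HodgeCycles, Andre1996Motifs
[crux] R1 (declared RESIDUAL conjunct, not attacked by this route) — the Hodge conjecture for
complex abelian varieties of dimension ≥ 8, where non-Weil exceptional classes exist (MZ99 Thm.
(d)(3): B²(X²) for Mumford-type fourfolds X). [difficulty: open-problem] -/
@[route_item "route-HodgeConjecture-SevenfoldWeilCensus", crux]
def HodgeAbelianDimGeEight : Prop :=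
  ∀ A : Literature.AlgebraicGeometry.Motives.AbelianVariety ℂ, 8 ≤ A.dim → Literature.AlgebraicGeometry.Motives.IsSmoothProjective A.dim A.X → Literature.AlgebraicGeometry.HodgeTheory.HodgeConjectureFor A.dim A.X

/-- item stmt-HodgeConjecture-15889 · crux · rank 9 · open · by planner
why it might fail: it is the Hodge conjecture off the abelian locus (surfaces of general type products, hyperkähler, Calabi–Yau …) — summit-strength residual, imported not attacked.
sources: Deligne1982HodgeCycles, Andre1996Motifs, vanGeemen1994HodgeAV
[crux] NOT THE ROUTE'S MECHANISM — the remainder of the summit, RESTATED 2026-08-16 (route-repair,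
ground) in COMPLEMENT form: the Hodge conjecture `HodgeTheory.HodgeConjectureFor n X` for every
smooth projective complex n-fold X that is NOT the underlying variety A.X of an n-dimensional
complex abelian variety A (X carries no abelian-variety structure). Rev 0 used verbatim the
conditional shared decl `ConservativityLefschetz.AbelianComplement`, `(∀ A, IsSmoothProjective A.dim
A.X → HodgeConjectureFor A.dim A.X) → HodgeConjecture`; since FaceReduction := RankFourWeilTransport
→ CMAbelianHodge and CMToAbelian := CMAbelianHodge → (HC for abelian varieties) are themselves
implications, that typing made the Assembly item a propositional tautology (ground battery:
ground.trivial tauto). Now the abelian locus is excluded in the hypothesis and the deciding theorem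
`closes` does the case split (X = A.X with A.dim = n: CMToAbelian (FaceReduction
RankFourWeilTransport) A; otherwise this item) — the typing pattern of
PadicSemiregularLift.HodgeBeyondAnchors without its Fermat exclusion. The clause A.dim = n is
automatic for X smooth projective of dimension n (schemeDim of a smooth projective n -/
@[route_item "route-HodgeConjecture-SevenfoldWeilCensus", crux]
def AbelianComplement : Prop :=
  ∀ ⦃n : ℕ⦄ ⦃X : Literature.AlgebraicGeometry.Motives.SchemeOver ℂ⦄, Literature.AlgebraicGeometry.Motives.IsSmoothProjective n X → (∀ A : Literature.AlgebraicGeometry.Motives.AbelianVariety ℂ, A.dim = n → A.X ≠ X) → Literature.AlgebraicGeometry.HodgeTheory.HodgeConjectureFor n X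

/-- item stmt-HodgeConjecture-18723 · support · rank 9 · open · by planner
sources: arXiv:2502.03415, arXiv:math/9901113, Markman2025SecantWeil
[support] Markman 2025 Cor. 1.3 with Moonen–Zarhin 1999: the Hodge conjecture (cycle part) for
complex abelian varieties of dimension ≤ 5 — BY NAME the claim-tagged Literature fact
`Markman2025_hodgeClasses_algebraic_abelian_dim_le_five` (the induction base of the glue).
[difficulty: open-problem] -/
@[route_item "route-HodgeConjecture-SevenfoldWeilCensus", crux]
def HodgeAbelianDimLeFive : Prop :=
  Literature.AlgebraicGeometry.HodgeTheory.Markman2025_hodgeClasses_algebraic_abelian_dim_le_five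

/-- item stmt-HodgeConjecture-18724 · assembly · rank 1 · closed · proved by Summit.HodgeConjecture.HodgeConjecture.Theorems.sevenfoldWeilCensus_assembly_proof @ 674f8bd141e6 (prover) · by planner
sources: arXiv:math/9901113, arXiv:2502.03415
[assembly] the SEVENFOLD REDUCTION (sketch P1, provable now — kernel-checked proof attached as
evidence): CodimTwoFromLowerDim → CodimThreeWeilGeneration → WeilSixfolds → HodgeAbelianDimLeFive →
the Hodge conjecture for every complex abelian variety of dimension ≤ 7 (the route's conjunct);
`closes` consumes it together with the two residuals. -/
@[route_item "route-HodgeConjecture-SevenfoldWeilCensus", crux]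
def Assembly : Prop :=
  CodimTwoFromLowerDim → CodimThreeWeilGeneration → WeilSixfolds → HodgeAbelianDimLeFive → ∀ A : Literature.AlgebraicGeometry.Motives.AbelianVariety ℂ, A.dim ≤ 7 → Literature.AlgebraicGeometry.Motives.IsSmoothProjective A.dim A.X → Literature.AlgebraicGeometry.HodgeTheory.HodgeConjectureFor A.dim A.X

/-! D-0027 §2.1 — DECIDING THEOREM (planner-authored via `route open/edit --closes-file`; by planner-type-24c06cf1ee-0 2026-08-17T17:18:52Z):
its hypotheses are this route's items and its conclusion the sub-problem Statement (glue_lint), and it elaborates with this file. -/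

@[closes "route-HodgeConjecture-SevenfoldWeilCensus"] theorem closes (hA : Assembly) (h₃ : CodimTwoFromLowerDim) (h₂ : CodimThreeWeilGeneration) (h₄ : WeilSixfolds)
    (h₅ : HodgeAbelianDimLeFive) (h₈ : HodgeAbelianDimGeEight) (h₉ : AbelianComplement) :
    _root_.HodgeConjecture := by
  -- case split of the summit statement: abelian of dimension ≤ 7 (the sevenfold reduction `Assembly`, fed with the
  -- two census cruxes, the shared Weil-sixfold crux and the dim ≤ 5 support) / abelian of dimension ≥ 8 (residual R1) /
  -- no abelian-variety structure (residual R2, shared with RankFourFaces)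
  intro n X hX
  by_cases hAb : ∃ A : Literature.AlgebraicGeometry.Motives.AbelianVariety ℂ, A.dim = n ∧ A.X = X
  · obtain ⟨A, rfl, rfl⟩ := hAb
    by_cases hd : A.dim ≤ 7
    · exact hA h₃ h₂ h₄ h₅ A hd hX
    · exact h₈ A (by omega) hX
  · exact h₉ hX fun A hA hAX => hAb ⟨A, hA, hAX⟩

end Summit.HodgeConjecture.HodgeConjecture.Theses.SevenfoldWeilCensus
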